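import Literature.Probability.Percolation.ShorteningInfluenceBound
import HarnessLib

/-! # Crux `PercNearOneGluing.NoHeavyLowerTail` (stmt-CriticalPhenomena-4575) — the CUMULATIVE-ISOLATION transpose of
# Kozma–Nitzan's Theorem 12: a CIL_j deficit forces the shortening-good pairs to have small total odds

Helper for the edge-shortening / merge-stability inductions of the crux (`stub_cumulativeIsolation`,
`stub_mergeStability`, `stub_championStabilityPair`; files `…NoHeavyLowerTailMergeStability.lean`,
`…ChampionStability*.lean`).  Written by the literature seat prim-gen-literature (gen 3, 2026-08-18),
landed verbatim `--supports stmt-CriticalPhenomena-4575` by prover prim-ineq-gen-5 gen 23 (Theorems/ is prover-only); the crux is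
meanwhile proved unconditionally (`CSH.noHeavyLowerTail_holds`, p205010) — this quantitative deficit bound is independent of that proof.

With `L = {1 ≤ |π(o)| ≤ j}`, `R_a = {|π(a)| ≤ j}` (`π(v) = {x ∈ A : v ↔ x}` as `A.filter`), any common upper
bound `M` of the `P_w(R_a)`, `a ∈ A` (e.g. `M = max_a P_w(R_a)`), and ANY finite set `E` of pairs `e` such that
CIL_j holds for the shortened weights `w[e ↦ 1]` (some `a ∈ A` has `P_{w[e↦1]}(L) ≤ P_{w[e↦1]}(R_a)`):

  `(P_w(L) − M)² · Σ_{e ∈ E} w_e/(1 − w_e) ≤ P_w(L)(1 − P_w(L)) (≤ 1/4)`   whenever `M ≤ P_w(L)`.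

Proof = Kozma–Nitzan's proof of their Theorem 12 (arXiv:2401.12397 §5.4 p. 35), transposed: for `e ∈ E`
with witness `a`, `P₁(L) ≤ P₁(R_a) ≤ P_w(R_a) ≤ M` (`R_a` is DECREASING, shortening raises weights), so the
influence `I_e(L) = P_{w[e↦1]}(L) − P_{w[e↦0]}(L)` has `(1 − w_e)(−I_e) = P_w(L) − P₁(L) ≥ P_w(L) − M =: m`
(affinity in one weight, `prodBernoulli_real_update_one_sub`); hence `m² w_e/(1−w_e) ≤ w_e(1−w_e) I_e²`, and
the level-1 inequality `prodBernoulli_levelOne_le` (`L` need not be monotone) sums these to `≤ P(L)(1−P(L))`.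
Reading (LITERATURE-GEN.md §3 S8 supplement): contractions onto a relay neighbour, free–free, free–relay and
o–free pairs are CIL_j instances on fewer vertices, so a vertex-minimal counterexample to CIL_j with deficit
`m` has `m² · Σ_{e ∉ A×A, w_e<1} w_e/(1−w_e) ≤ P(L)(1−P(L))`: its non-(relay–relay) sub-unit weight is light in
total odds — the hub-and-spoke / NW-CIL regime.  Like KN's Theorem 12 this bounds HOW MUCH CIL_j can fail,
not whether.  No new definitions, no named facts. -/

namespace Summit.CriticalPhenomena.PercolationContinuityZ3.Theorems

open MeasureTheory Set
open Literature.Probability.LatticeModels (prodBernoulli prodBernoulli_real_mono_of_isUpperSet)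
open Literature.Probability.Percolation

noncomputable section
open Classical

/-- The relay trace `π(v) = {x ∈ A : v ↔ x}` grows with the configuration. [folklore] -/
theorem cilDeficit_filter_card_mono {n : ℕ} (A : Finset (Fin n)) (v : Fin n) {ω ω' : BondConfig (Fin n)}
    (h : ω ≤ ω') :
    (A.filter fun x => ω ∈ openConn v x).card ≤ (A.filter fun x => ω' ∈ openConn v x).card := by
  classical
  refine Finset.card_le_card fun x hx => ?_
  rw [Finset.mem_filter] at hx ⊢
  exact ⟨hx.1, isUpperSet_openConn v x h hx.2⟩

/-- The light-block event `R_v = {|π(v)| ≤ j}` is decreasing: its complement is an upper set. [folklore] -/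
theorem cilDeficit_isUpperSet_compl_light {n : ℕ} (A : Finset (Fin n)) (v : Fin n) (j : ℕ) :
    IsUpperSet ({ω : BondConfig (Fin n) | (A.filter fun x => ω ∈ openConn v x).card ≤ j}ᶜ) := by
  intro ω ω' h hω
  simp only [Set.mem_compl_iff, Set.mem_setOf_eq, not_le] at hω ⊢
  exact lt_of_lt_of_le hω (cilDeficit_filter_card_mono A v h)

/-- Shortening a pair (weight `↦ 1`) can only DEcrease the probability of a light block. [folklore] -/
theorem cilDeficit_light_update_one_le {n : ℕ} (w : Sym2 (Fin n) → unitInterval) (A : Finset (Fin n))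
    (v : Fin n) (j : ℕ) (e : Sym2 (Fin n)) :
    (prodBernoulli (Function.update w e 1)).real
        {ω : BondConfig (Fin n) | (A.filter fun x => ω ∈ openConn v x).card ≤ j} ≤
      (prodBernoulli w).real {ω : BondConfig (Fin n) | (A.filter fun x => ω ∈ openConn v x).card ≤ j} := by
  classical
  set R : Set (BondConfig (Fin n)) := {ω | (A.filter fun x => ω ∈ openConn v x).card ≤ j} with hR
  have hRm : MeasurableSet R := MeasurableSet.of_discrete
  have hmono : (prodBernoulli w).real Rᶜ ≤ (prodBernoulli (Function.update w e 1)).real Rᶜ :=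
    prodBernoulli_real_mono_of_isUpperSet (le_update_one w e) (cilDeficit_isUpperSet_compl_light A v j)
      hRm.compl
  have h1 := measureReal_compl (μ := prodBernoulli w) hRm
  have h2 := measureReal_compl (μ := prodBernoulli (Function.update w e 1)) hRm
  rw [probReal_univ] at h1 h2
  linarith

/-- **CIL-deficit influence bound** (Kozma–Nitzan Thm 12 transposed to cumulative isolation).  For every
weighted graph `w` on `Fin n`, relay set `A`, observer `o`, level `j`, every common upper bound `M ≤ P_w(L)` of
the light-block probabilities `P_w(|π(a)| ≤ j)` (`a ∈ A`), and every finite set `E` of pairs whose shortening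
`w[e ↦ 1]` satisfies CIL_j:
`(P_w(L) − M)² · Σ_{e∈E} w_e/(1 − w_e) ≤ P_w(L)(1 − P_w(L))`, `L = {1 ≤ |π(o)| ≤ j}`.
[cite: KozmaNitzan2024, §5.4 Theorem 12 (pp. 34–35) — proof transposed; tree `KozmaNitzan2024_thm12_var`] -/
theorem cumulativeIsolation_deficit_influence_bound (n : ℕ) (w : Sym2 (Fin n) → unitInterval)
    (A : Finset (Fin n)) (o : Fin n) (j : ℕ) (M : ℝ)
    (hM : ∀ a ∈ A, (prodBernoulli w).real
        {ω : BondConfig (Fin n) | (A.filter fun x => ω ∈ openConn a x).card ≤ j} ≤ M)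
    (E : Finset (Sym2 (Fin n)))
    (hE : ∀ e ∈ E, ∃ a ∈ A,
      (prodBernoulli (Function.update w e 1)).real
          {ω : BondConfig (Fin n) |
            1 ≤ (A.filter fun x => ω ∈ openConn o x).card ∧ (A.filter fun x => ω ∈ openConn o x).card ≤ j} ≤
        (prodBernoulli (Function.update w e 1)).real
          {ω : BondConfig (Fin n) | (A.filter fun x => ω ∈ openConn a x).card ≤ j})
    (hm : M ≤ (prodBernoulli w).real
        {ω : BondConfig (Fin n) |
          1 ≤ (A.filter fun x => ω ∈ openConn o x).card ∧ (A.filter fun x => ω ∈ openConn o x).card ≤ j}) :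
    ((prodBernoulli w).real
          {ω : BondConfig (Fin n) |
            1 ≤ (A.filter fun x => ω ∈ openConn o x).card ∧ (A.filter fun x => ω ∈ openConn o x).card ≤ j} - M) ^ 2 *
        ∑ e ∈ E, (w e : ℝ) / (1 - (w e : ℝ)) ≤
      (prodBernoulli w).real
          {ω : BondConfig (Fin n) |
            1 ≤ (A.filter fun x => ω ∈ openConn o x).card ∧ (A.filter fun x => ω ∈ openConn o x).card ≤ j} *
        (1 - (prodBernoulli w).real
          {ω : BondConfig (Fin n) |
            1 ≤ (A.filter fun x => ω ∈ openConn o x).card ∧ (A.filter fun x => ω ∈ openConn o x).card ≤ j}) := by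
  classical
  set L : Set (BondConfig (Fin n)) := {ω | 1 ≤ (A.filter fun x => ω ∈ openConn o x).card ∧
    (A.filter fun x => ω ∈ openConn o x).card ≤ j} with hL
  set m : ℝ := (prodBernoulli w).real L - M with hmdef
  have hm0 : 0 ≤ m := by rw [hmdef]; linarith
  have hB : DeterminedBy L (↑(Finset.univ : Finset (Sym2 (Fin n))) : Set (Sym2 (Fin n))) :=
    determinedBy_coe_univ L
  -- Step 1: for `e ∈ E`, `P_w(L) - P_{w[e↦1]}(L) ≥ m`.
  have hstep : ∀ e ∈ E, m ≤ (prodBernoulli w).real L - (prodBernoulli (Function.update w e 1)).real L := by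
    intro e he
    obtain ⟨a, ha, hle⟩ := hE e he
    have h1 := cilDeficit_light_update_one_le w A a j e
    have h2 := hM a ha
    rw [hmdef]
    linarith
  -- Step 2: affinity, `(1 - w_e)(-I_e) ≥ m`.
  have hslope : ∀ e ∈ E, m ≤ (1 - (w e : ℝ)) *
      -((prodBernoulli (Function.update w e 1)).real L - (prodBernoulli (Function.update w e 0)).real L) := by
    intro e he
    rw [mul_neg, ← prodBernoulli_real_update_one_sub hB w (Finset.mem_univ e)]
    have := hstep e he
    linarith
  -- Step 3: termwise bound.
  have hterm : ∀ e ∈ E, m ^ 2 * ((w e : ℝ) / (1 - (w e : ℝ))) ≤ (w e : ℝ) * (1 - (w e : ℝ)) *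
      ((prodBernoulli (Function.update w e 1)).real L - (prodBernoulli (Function.update w e 0)).real L) ^ 2 := by
    intro e he
    set I : ℝ := (prodBernoulli (Function.update w e 1)).real L -
      (prodBernoulli (Function.update w e 0)).real L with hI
    have hw0 : 0 ≤ (w e : ℝ) := (w e).2.1
    have hw1 : (w e : ℝ) ≤ 1 := (w e).2.2
    rcases eq_or_lt_of_le hw1 with h1 | h1
    · rw [h1]; simp
    · have hpos : 0 < 1 - (w e : ℝ) := sub_pos.2 h1
      have hsq : m ^ 2 ≤ ((1 - (w e : ℝ)) * -I) ^ 2 := pow_le_pow_left₀ hm0 (hslope e he) 2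
      have hdiv : 0 ≤ (w e : ℝ) / (1 - (w e : ℝ)) := div_nonneg hw0 hpos.le
      calc m ^ 2 * ((w e : ℝ) / (1 - (w e : ℝ)))
          ≤ ((1 - (w e : ℝ)) * -I) ^ 2 * ((w e : ℝ) / (1 - (w e : ℝ))) :=
            mul_le_mul_of_nonneg_right hsq hdiv
        _ = (w e : ℝ) * (1 - (w e : ℝ)) * I ^ 2 := by
            field_simp
  -- Step 4: sum and apply the level-1 inequality (`L` is not monotone; Bessel does not care).
  calc m ^ 2 * ∑ e ∈ E, (w e : ℝ) / (1 - (w e : ℝ))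
      = ∑ e ∈ E, m ^ 2 * ((w e : ℝ) / (1 - (w e : ℝ))) := Finset.mul_sum _ _ _
    _ ≤ ∑ e ∈ E, (w e : ℝ) * (1 - (w e : ℝ)) *
          ((prodBernoulli (Function.update w e 1)).real L -
            (prodBernoulli (Function.update w e 0)).real L) ^ 2 := Finset.sum_le_sum hterm
    _ ≤ ∑ e ∈ (Finset.univ : Finset (Sym2 (Fin n))), (w e : ℝ) * (1 - (w e : ℝ)) *
          ((prodBernoulli (Function.update w e 1)).real L -
            (prodBernoulli (Function.update w e 0)).real L) ^ 2 := by
        refine Finset.sum_le_sum_of_subset_of_nonneg (Finset.subset_univ E) fun e _ _ => ?_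
        exact mul_nonneg (mul_nonneg (w e).2.1 (sub_nonneg.2 (w e).2.2)) (sq_nonneg _)
    _ ≤ (prodBernoulli w).real L * (1 - (prodBernoulli w).real L) := prodBernoulli_levelOne_le hB w

/-- Max form: with `M = max_{a ∈ A} P_w(|π(a)| ≤ j)` the deficit of `stub_cumulativeIsolation` itself,
`m = P_w(L) − max_a P_w(R_a) ≥ 0 ⇒ m² · Σ_{e∈E} w_e/(1−w_e) ≤ 1/4`. [cite: KozmaNitzan2024, §5.4 Theorem 12 (transposed)] -/
theorem cumulativeIsolation_deficit_influence_bound_sup (n : ℕ) (w : Sym2 (Fin n) → unitInterval)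
    (A : Finset (Fin n)) (hA : A.Nonempty) (o : Fin n) (j : ℕ) (E : Finset (Sym2 (Fin n)))
    (hE : ∀ e ∈ E, ∃ a ∈ A,
      (prodBernoulli (Function.update w e 1)).real
          {ω : BondConfig (Fin n) |
            1 ≤ (A.filter fun x => ω ∈ openConn o x).card ∧ (A.filter fun x => ω ∈ openConn o x).card ≤ j} ≤
        (prodBernoulli (Function.update w e 1)).real
          {ω : BondConfig (Fin n) | (A.filter fun x => ω ∈ openConn a x).card ≤ j})
    (hm : A.sup' hA (fun a => (prodBernoulli w).real
        {ω : BondConfig (Fin n) | (A.filter fun x => ω ∈ openConn a x).card ≤ j}) ≤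
      (prodBernoulli w).real
        {ω : BondConfig (Fin n) |
          1 ≤ (A.filter fun x => ω ∈ openConn o x).card ∧ (A.filter fun x => ω ∈ openConn o x).card ≤ j}) :
    ((prodBernoulli w).real
          {ω : BondConfig (Fin n) |
            1 ≤ (A.filter fun x => ω ∈ openConn o x).card ∧ (A.filter fun x => ω ∈ openConn o x).card ≤ j} -
        A.sup' hA (fun a => (prodBernoulli w).real
          {ω : BondConfig (Fin n) | (A.filter fun x => ω ∈ openConn a x).card ≤ j})) ^ 2 *
        ∑ e ∈ E, (w e : ℝ) / (1 - (w e : ℝ)) ≤ 1 / 4 := by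
  have hM : ∀ a ∈ A, (prodBernoulli w).real
      {ω : BondConfig (Fin n) | (A.filter fun x => ω ∈ openConn a x).card ≤ j} ≤
        A.sup' hA (fun a => (prodBernoulli w).real
          {ω : BondConfig (Fin n) | (A.filter fun x => ω ∈ openConn a x).card ≤ j}) :=
    fun a ha => Finset.le_sup' (fun a => (prodBernoulli w).real
      {ω : BondConfig (Fin n) | (A.filter fun x => ω ∈ openConn a x).card ≤ j}) ha
  refine (cumulativeIsolation_deficit_influence_bound n w A o j _ hM E hE hm).trans ?_
  nlinarith [sq_nonneg ((prodBernoulli w).real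
    {ω : BondConfig (Fin n) |
      1 ≤ (A.filter fun x => ω ∈ openConn o x).card ∧ (A.filter fun x => ω ∈ openConn o x).card ≤ j} - 1 / 2)]

end

end Summit.CriticalPhenomena.PercolationContinuityZ3.Theorems
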